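import Literature.RepresentationTheory.MoeglinVignerasWaldspurger1987.RankOneThetaCharacterRatio
import Literature.RepresentationTheory.CompactAbelianTypeDichotomy
import HarnessLib

/-!
# The `(U(1), U(1))` theta dichotomy at a non-split place, character route: the type sets of the two rank-one
# oscillator representations attached to lines in different classes are complementary

[MoeglinVignerasWaldspurger1987] C. Mœglin, M.-F. Vignéras, J.-L. Waldspurger, *Correspondances de Howe sur un corps
`p`-adique*, LNM 1291 (1987), Chap. 3 §IV.4 (dichotomy for the dual pair `(U(1), U(1))`): for the compact torus
`T = U(J₁)(F_v) = E_v¹` at a non-split place `v` and two trace-zero elements `δ₁`, `δ₂ = αδ₁` with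
`(α, d₁)_v = -1` (lines in different classes), the oscillator representations `ω_{s₁}`, `ω_{s₂}` of `T` (sections `sᵢ`
over `ι_{δᵢ}`) satisfy **`rankOne_theta_dichotomy`**: there is a character `θ` of `T` with open kernel such that for
every open-kernel character `ξ` of `T`

`dim ω_{s₁}[ξ] + dim ω_{s₂}[ξθ] = 1`,

i.e. `ξ` occurs in exactly one of `ω_{s₁}`, `ω_{s₂} ⊗ θ⁻¹` (and then with multiplicity one).  This is the cell's
(`hodgecm-mathlib`, h413 road, SOCKETS-H413 v0.2 §3 S6 «G2a») `(U(1),U(1))` brick, obtained by the CHARACTER ROUTE: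
★ `TwistedCoinv.finrank_weightSpace_add_eq_one_of_trace_eq_neg` (complementary type sets from a finite-level
character relation) fed with multiplicity one ★ `finiteDimensional_weightSpace_rankOne`, the character relation
★ `rankOne_theta_character_ratio` (`tr ω₂ = -θ · tr ω₁` off `{±1}`) and the reflection asymmetry ★
`rankOne_reflection_asymmetry`.  THEOREMS ONLY; count-neutral; HC_CM is proved only modulo the 7 printed
citations until rung 0 closes.

## References
* [MoeglinVignerasWaldspurger1987] LNM 1291 (1987), Chap. 3 §IV.4 Théorème principal; Chap. 2 II.1 (A), II.8.
* [Weil1964] A. Weil, Acta Math. 111 (1964) 143–211, Chap. I n° 14.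
-/

set_option autoImplicit false

noncomputable section

open NumberField IsDedekindDomain Matrix MeasureTheory
open scoped Matrix MatrixGroups NNReal Topology
open Literature.RepresentationTheory Literature.RepresentationTheory.HeisenbergGroup
open Literature.RepresentationTheory.TwistedCoinv
open Literature.NumberTheory.GelbartRogawski1991.UnitaryDualPair.LocalSplitting
open Literature.NumberTheory.Automorphic Literature.NumberTheory.Automorphic.UnitaryGroup
open Literature.NumberTheory.Automorphic.Liu2021
open Literature.NumberTheory.GaloisRepresentations.IsNonarchimedeanLocalField
open Literature.NumberTheory.Weil1964 Literature.NumberTheory.QuadraticForms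

namespace Literature.RepresentationTheory.MoeglinVignerasWaldspurger1987

variable (F : Type) [Field F] [NumberField F] (E : Type) [Field E] [NumberField E] [Algebra F E]
  [Algebra.IsQuadraticExtension F E] (c : E ≃ₐ[F] E)
  (δ₁ : E) (hcδ₁ : c δ₁ = -δ₁) (hδ₁ : δ₁ ≠ 0) (d₁ : F) (hd₁ : δ₁ * δ₁ = algebraMap F E d₁)
  (δ₂ : E) (hcδ₂ : c δ₂ = -δ₂) (hδ₂ : δ₂ ≠ 0) (d₂ : F) (hd₂ : δ₂ * δ₂ = algebraMap F E d₂)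
  (α : F) (hα0 : α ≠ 0) (hα : δ₂ = algebraMap F E α * δ₁)
  (t : Matrix (Fin 1) (Fin 1) F) (ht : t.IsSymm) (htd : IsUnit t.det)
  (J₁ : Matrix (Fin 1) (Fin 1) E) (hJ₁ : J₁ = t.map (algebraMap F E)) (v : HeightOneSpectrum (𝓞 F))
  (hE : IsField (UnitaryGroup.LocalRing E v))
  (s₁ : localPi E c 1 J₁ v →* LocalMp F 1 t v)
  (hs₁ : ∀ g, MpPsi.proj _ (s₁ g) = iota F E c 1 hcδ₁ hδ₁ hd₁ t ht hJ₁ v g)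
  (hsm₁ : Representation.IsSmooth ((MpPsi.toRep (localSchrodinger F 1 t v)).comp s₁))
  (s₂ : localPi E c 1 J₁ v →* LocalMp F 1 t v)
  (hs₂ : ∀ g, MpPsi.proj _ (s₂ g) = iota F E c 1 hcδ₂ hδ₂ hd₂ t ht hJ₁ v g)
  (hsm₂ : Representation.IsSmooth ((MpPsi.toRep (localSchrodinger F 1 t v)).comp s₂))

include hcδ₁ hδ₁ hd₁ hcδ₂ hδ₂ hd₂ hα0 hα ht htd hJ₁ hE hs₁ hsm₁ hs₂ hsm₂ in
/-- **THE `(U(1), U(1))` THETA DICHOTOMY (non-split place, lines in different classes).**  For the oscillator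
representations `ω_{s₁}, ω_{s₂}` of the compact torus `U(J₁)(F_v)` attached to `δ₁` and `δ₂ = αδ₁` with
`(α, d₁)_v = -1`, there is an open-kernel character `θ` with `dim ω_{s₁}[ξ] + dim ω_{s₂}[ξθ] = 1` for every open-kernel
character `ξ`: each `ξ` occurs in exactly one of `ω_{s₁}`, `ω_{s₂} ⊗ θ⁻¹`, with multiplicity one (any auxiliary Haar
measure `μ` and conductor exponent `m` of `ψ_v` may be supplied).
[cite: MoeglinVignerasWaldspurger1987, Chap. 3 §IV.4 Théorème principal] -/
theorem rankOne_theta_dichotomy [MeasurableSpace (v.adicCompletion F)] [BorelSpace (v.adicCompletion F)]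
    (μ : Measure (v.adicCompletion F)) [μ.IsAddHaarMeasure] (m : ℤ) (hm : (adeleAddCharAt F v).HasConductorExp m)
    (hclass : hilbertSymbol (v.adicCompletion F) (α : v.adicCompletion F) (d₁ : v.adicCompletion F) = -1) :
    ∃ θ : localPi E c 1 J₁ v →* ℂˣ, IsOpen (θ.ker : Set (localPi E c 1 J₁ v)) ∧
      ∀ ξ : localPi E c 1 J₁ v →* ℂˣ, IsOpen (ξ.ker : Set (localPi E c 1 J₁ v)) →
        Module.finrank ℂ (weightSpace ((MpPsi.toRep (localSchrodinger F 1 t v)).comp s₁) id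
            (fun k => ((ξ k : ℂˣ) : ℂ))) +
          Module.finrank ℂ (weightSpace ((MpPsi.toRep (localSchrodinger F 1 t v)).comp s₂) id
            (fun k => (((ξ * θ) k : ℂˣ) : ℂ))) = 1 := by
  haveI : CompactSpace (localPi E c 1 J₁ v) := compactSpace_localPi_rankOne F E c hcδ₁ hδ₁ htd hJ₁ v hE
  have hcomm := localPi_one_mul_comm E c J₁ v
  have A := rankOne_theta_character_ratio F E c δ₁ hcδ₁ hδ₁ d₁ hd₁ δ₂ hcδ₂ hδ₂ d₂ hd₂ α hα0 hα t ht htd J₁ hJ₁ v hE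
    s₁ hs₁ hsm₁ s₂ hs₂ hsm₂ μ m hm hclass
  have hθo := A.choose_spec.1
  have hrel := A.choose_spec.2
  refine ⟨A.choose, hθo, fun ξ hξ => ?_⟩
  -- multiplicity one for both oscillator representations
  have hfin₁ : ∀ χ : localPi E c 1 J₁ v →* ℂˣ, IsOpen (χ.ker : Set (localPi E c 1 J₁ v)) →
      Module.Finite ℂ (weightSpace ((MpPsi.toRep (localSchrodinger F 1 t v)).comp s₁) id (fun k => ((χ k : ℂˣ) : ℂ))) ∧
        Module.finrank ℂ (weightSpace ((MpPsi.toRep (localSchrodinger F 1 t v)).comp s₁) id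
          (fun k => ((χ k : ℂˣ) : ℂ))) ≤ 1 := fun χ hχ =>
    finiteDimensional_weightSpace_rankOne F E c hcδ₁ hδ₁ hd₁ ht htd hJ₁ v hE s₁ hs₁ hsm₁ χ
      (norm_apply_eq_one_of_isOpen_ker_rankOne F E c hcδ₁ hδ₁ htd hJ₁ v hE χ hχ)
      (continuous_apply_of_isOpen_ker_rankOne F E c htd hJ₁ v χ hχ)
  have hfin₂ : ∀ χ : localPi E c 1 J₁ v →* ℂˣ, IsOpen (χ.ker : Set (localPi E c 1 J₁ v)) →
      Module.Finite ℂ (weightSpace ((MpPsi.toRep (localSchrodinger F 1 t v)).comp s₂) id (fun k => ((χ k : ℂˣ) : ℂ))) ∧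
        Module.finrank ℂ (weightSpace ((MpPsi.toRep (localSchrodinger F 1 t v)).comp s₂) id
          (fun k => ((χ k : ℂˣ) : ℂ))) ≤ 1 := fun χ hχ =>
    finiteDimensional_weightSpace_rankOne F E c hcδ₂ hδ₂ hd₂ ht htd hJ₁ v hE s₂ hs₂ hsm₂ χ
      (norm_apply_eq_one_of_isOpen_ker_rankOne F E c hcδ₂ hδ₂ htd hJ₁ v hE χ hχ)
      (continuous_apply_of_isOpen_ker_rankOne F E c htd hJ₁ v χ hχ)
  -- the reflection asymmetry, read on `W = 𝒮^L`
  have R := rankOne_reflection_asymmetry F E c δ₁ hcδ₁ hδ₁ d₁ hd₁ t ht htd J₁ hJ₁ v hE s₁ hs₁ hsm₁ μ m hm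
  have hasym : ∃ z : localPi E c 1 J₁ v, ∃ K₀ : Subgroup (localPi E c 1 J₁ v), IsOpen (K₀ : Set (localPi E c 1 J₁ v)) ∧
      z ∉ K₀ ∧ localUnitScalar E c J₁ v (-1) (negOne_mul_conjLocal_negOne E c v) * z ∉ K₀ ∧
      ∀ L : Subgroup (localPi E c 1 J₁ v), IsOpen (L : Set (localPi E c 1 J₁ v)) → L ≤ K₀ →
        ‖LinearMap.trace ℂ (Representation.fixedPoints ((MpPsi.toRep (localSchrodinger F 1 t v)).comp s₁) L)
            ((((MpPsi.toRep (localSchrodinger F 1 t v)).comp s₁)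
                (localUnitScalar E c J₁ v (-1) (negOne_mul_conjLocal_negOne E c v) * z)).restrict
              (apply_mem_fixedPoints_of_comm ((MpPsi.toRep (localSchrodinger F 1 t v)).comp s₁) hcomm L
                (localUnitScalar E c J₁ v (-1) (negOne_mul_conjLocal_negOne E c v) * z)))‖ ≠
          ‖LinearMap.trace ℂ (Representation.fixedPoints ((MpPsi.toRep (localSchrodinger F 1 t v)).comp s₁) L)
            ((((MpPsi.toRep (localSchrodinger F 1 t v)).comp s₁) z).restrict
              (apply_mem_fixedPoints_of_comm ((MpPsi.toRep (localSchrodinger F 1 t v)).comp s₁) hcomm L z))‖ := by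
    refine ⟨R.choose, R.choose_spec.choose, R.choose_spec.choose_spec.1, R.choose_spec.choose_spec.2.1,
      R.choose_spec.choose_spec.2.2.1, fun L hLo hLK => ?_⟩
    haveI : FiniteDimensional ℂ (Representation.fixedPoints ((MpPsi.toRep (localSchrodinger F 1 t v)).comp s₁) L) :=
      finite_fixedPoints_of_finite_weightSpace _ hcomm L hLo fun χ hχ => (hfin₁ χ (Subgroup.isOpen_mono hχ hLo)).1
    exact R.choose_spec.choose_spec.2.2.2 L hLo hLK _ (fun f => Representation.mem_fixedPoints _ L f) _ _
  exact finrank_weightSpace_add_eq_one_of_trace_eq_neg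
    ((MpPsi.toRep (localSchrodinger F 1 t v)).comp s₁) ((MpPsi.toRep (localSchrodinger F 1 t v)).comp s₂)
    hcomm hfin₁ hfin₂ (localUnitScalar_negOne_mul_self E c J₁ v) A.choose hθo hrel hasym ξ hξ

end Literature.RepresentationTheory.MoeglinVignerasWaldspurger1987

end
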